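import Literature.MeasureTheory.Group.QuotientOrbitalIntegralProperContinuity   -- ★ p849573 LH2-p04 (g3): (HYP) «uniformly proper modulo `M`» ⇒ `continuousOn_integral_descConj_of_uniformlyProper`
import Literature.NumberTheory.Automorphic.UnitaryFormGroupUnimodular             -- ★ `isClosed_unitaryGroupOfForm_complex`, `locallyCompactSpace_unitaryGroupOfForm_complex`
import Literature.NumberTheory.Automorphic.IwasawaDecompositionArchUnitary        -- ★ `mem_unitaryGroupOfForm_starRingEnd_iff`
import HarnessLib

/-!
# Uniform properness modulo the SPLIT Cartan of `U(1,1) = U(Φ₂)(ℂ)` and continuity of the Weil-quotient orbital integral along it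
# («(W1-cont-H)» FILE 1: Rogawski 1990 §3.1, §3.6, §8.3; Shelstad 1979 §4; Deitmar–Echterhoff 2014 Lemma 9.3.3)

Topic `NumberTheory/Rogawski1990`; namespace `Literature.NumberTheory.Rogawski1990`.  THEOREMS ONLY (no `def`, no instance, no notation, no axiom, no named fact, no
`sorry`).  Cell `pub/hodgecm-mathlib`, crux H413 (`stmt-HodgeConjecture-24833`), F0∕P3c line LH3 (closer stub `stub_N9`, DIRECT ROAD «Transf»; board item
«(W1-cont-H) `continuousOn_chartOrbH_regS`» of LH3-plan (g2)'s SEAM RULING 2026-09-02T05:53:17Z (b), count-neutral hardening); seat F0P3a-p09 (g5).  The rank-ONE twin of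
★ `ArchHyperbolicOrbitProperThree` (LH3-p03 (g2), `U(2,1)`): the one per-place input of the `H_∞ = U(Φ₂)_∞ × U(Φ₁)_∞`-side continuity that was missing — at a SPLIT
place the `U(Φ₂)`-block of the chart torus `T_S` (★ `chartTorusH`, (T-MEAS)) is the NON-compact diagonal torus `{diag(λ, λ̄⁻¹)}`, so the chart orbital functional
`chartOrbH` (★ p849670) is a Weil QUOTIENT integral and its continuity in the torus parameter needs uniform properness MODULO the torus.

THE FORM.  `J = Φ₂ = antidiag(1,1)` in the tree's spelling `Matrix.of fun i j : Fin 2 => if i.val + j.val + 1 = 2 then 1 else 0`; the file is written over a matrix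
VARIABLE `J` with `hJ : J = Φ₂` so that it applies verbatim both to `U := unitaryGroupOfForm (starRingEnd ℂ) Φ₂` and to the place factors
`archLocal L 2 Φ₂ w = unitaryGroupOfForm (starRingEnd ℂ) (Φ₂.map σ_w)` of `U(Φ₂)_∞` (★ `antidiagOne_map`: `Φ₂.map σ_w = Φ₂`), with no transport.

THE MATHEMATICS (elementary; no disc model, no Iwasawa decomposition).  Let `y ∈ U(Φ₂)(ℂ)` and `t = diag(a, ā⁻¹)` a REGULAR split element (`|a| ≠ 1`, i.e. `a ≠ ā⁻¹`;
★ `diag_mem_unitary_antidiag_iff`: the diagonal elements of `U(Φ₂)` are exactly the `diag(λ, λ̄⁻¹)`).  Write `y = (p q; r s)`; `|det y| = 1` (§1).  Then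
`y t y⁻¹ = det(y)⁻¹ · (a ps − ā⁻¹ qr, (ā⁻¹ − a) pq; (a − ā⁻¹) rs, ā⁻¹ ps − a qr)`, so if the entries of `y t y⁻¹` are bounded by `ρ` then
`|pq|, |rs| ≤ m := ρ ∕ |a − ā⁻¹|`; with `|ps − qr| = 1` and `|ps|·|qr| = |pq|·|rs| ≤ m²` one gets `min(|ps|, |qr|) ≤ m`, hence `|ps|, |qr| ≤ m + 1`, and
`(|p|² + |r|²)(|q|² + |s|²) = |pq|² + |ps|² + |rq|² + |rs|² ≤ 2m² + 2(m+1)²`.  Right-translating `y` by the torus element `τ = diag(c, c⁻¹)`, `c > 0` real, `c² = N₂ ∕ N₁`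
(`N₁, N₂` the two column norms) EQUALISES the column norms at `√(N₁N₂)`, so every entry of `y τ` is bounded by `(2m² + 2(m+1)²)^{1∕4}` — a bound depending on `t` only
through `|a − ā⁻¹|⁻¹`, which is bounded on compact sets of regular elements.  Matrix-bounded subsets of `U(Φ₂)(ℂ)` are compact (`g⁻¹ = Φ₂ gᴴ Φ₂`; the closed embedding
`g ↦ (g, g⁻¹)`), so the classes `y T` with `y t y⁻¹` in a fixed compact, `t` in a compact regular set, lie in ONE compact subset of `U ⧸ T`.
* §1 `U(Φ₂)(ℂ)` bookkeeping: `norm_det_eq_one_of_mem₂`, `coe_inv_eq_of_mem₂` (`(g⁻¹)_{ij} = conj g_{1−j,1−i}`), **`isCompact_setOf_forall_norm_le₂`**, the torus elements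
  `diag(c, c̄⁻¹) ∈ U(Φ₂)` (`diagHyp_mem₂`, `exists_coe_eq_diagReal₂`).
* §2 **`exists_diag_mul_forall_norm_le₂`** — THE COLUMN-BALANCING LEMMA (one `y`, one regular `t`, explicit bound).
* §3 **`exists_isCompact_forall_exists_mul_diag_mem₂`** — GROUP-LEVEL TRANSLATE FORM for ANY continuous chart `c : X → U(Φ₂)` with diagonal values `diag(a(x), ā(x)⁻¹)`:
  over a compact `K ⊆ {x ∣ |a(x)| ≠ 1}` and a compact `C`, ONE compact `B ⊆ U(Φ₂)(ℂ)` contains a torus translate `y · diag(r, r⁻¹)` (`r > 0`) of every `y` with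
  `y c(x) y⁻¹ ∈ C` (the form the places assembly of «(W1-cont-H)» consumes); **`uniformlyProper_of_coe_eq_diagHyp₂`** — the (HYP) of
  ★ `continuousOn_integral_descConj_of_uniformlyProper` MODULO ANY subgroup `M` containing the diagonal elements of `U(Φ₂)` (e.g. the split block of ★ `chartTorusH S`
  at `w ∈ S`, or the centraliser `Z(t₀)` of a regular split `t₀`: `mem_centralizer_of_apply_eq_zero₂`, `uniformlyProper_centralizer_of_coe_eq_diagHyp₂`).
* §4 **`continuousOn_integral_descConj_of_coe_eq_diagHyp₂`** — for `f ∈ C_c(U, E)` and ANY measure on `U ⧸ M` finite on compact sets, `x ↦ ∫_{U ⧸ M} f(y · c(x) · y⁻¹) dμ(ȳ)`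
  (★ `descConj`) is continuous on `{x ∣ |a(x)| ≠ 1}` (★ engine p849573 §1).
NOT HERE (FILE 2, statement-first to the (T-MEAS) owner): the dock `continuousOn_chartOrbH_regS` on `H_∞` over ★ `archPiEquivCM`, ★ `uniformlyProper_pi`, the Cayley
frame at compact places (★ `uniformlyProper_circleDiagonal`) and the compact factor `U(Φ₁)_∞`.  HONEST LABEL: HC_CM is proved only modulo the 7 printed citations (2
remaining named inputs: hLiu418 = `stmt-HodgeConjecture-24832`, h413 = `stmt-HodgeConjecture-24833`) until rung 0 closes; this file is count-neutral (VOL)∕(CONV)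
kit under the LH3 letters and pays no organ.

## References
* [Rogawski1990] J. D. Rogawski, *Automorphic Representations of Unitary Groups in Three Variables*, Ann. of Math. Stud. 123 (1990), §3.1 p. 19 (`U(1,1)`, its tori),
  §3.6 p. 31 (Cartan subgroups), §4.9 p. 54 (`H = U(2) × U(1)`, `U(1,1) × U(1)`), §8.3 p. 122 (orbital integrals as functions on `T_reg`).
* [Shelstad1979] D. Shelstad, *Characters and inner forms of a quasi-split group over ℝ*, Compositio Math. 39 (1979), §4 pp. 22–23 (orbital integrals on `T_reg`,
  arbitrary `dt`; properness of conjugation on the regular set).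
* [DeitmarEchterhoff2014] A. Deitmar, S. Echterhoff, *Principles of Harmonic Analysis*, 2nd ed. (2014), Lemma 9.3.3 (orbital integrals of `C_c` functions converge and
  vary continuously on the regular set), Thm. 1.5.3 (quotient integral formula).
* [Knapp1986] A. W. Knapp, *Representation Theory of Semisimple Groups* (1986), Ch. V §3, Ch. XI §7 (regular orbits are closed; orbital integrals on `SU(1,1)`).
-/

set_option autoImplicit false

noncomputable section

open MeasureTheory MeasureTheory.Measure Set Complex ComplexConjugate Topology
open Literature.NumberTheory.Automorphic Literature.NumberTheory.Automorphic.UnitaryGroup Literature.MeasureTheory.Group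
open scoped MatrixGroups Matrix

namespace Literature.NumberTheory.Rogawski1990

/-! ## §1 `U(Φ₂)(ℂ)` bookkeeping: `|det| = 1`, the inverse, compactness of matrix-bounded sets, the diagonal torus -/

section Group

variable {J : Matrix (Fin 2) (Fin 2) ℂ} (hJ : J = Matrix.of fun i j : Fin 2 => if i.val + j.val + 1 = 2 then (1 : ℂ) else 0)

/-- `Φ₂ = !![0, 1; 1, 0]` entrywise (a `private` copy of ★ `antidiagTwo_eq` at `L = ℂ`, to keep the imports light). [cite: Rogawski1990, §3.1 p. 19] -/
private theorem antidiagTwo_eq' : (Matrix.of fun i j : Fin 2 => if i.val + j.val + 1 = 2 then (1 : ℂ) else 0) = !![0, 1; 1, 0] := by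
  ext i j
  fin_cases i <;> fin_cases j <;> rfl

include hJ in
/-- The unitarity relation `gᴴ Φ₂ g = Φ₂` of an element of `U(Φ₂)(ℂ)`, with `Φ₂ = !![0, 1; 1, 0]`. [cite: Rogawski1990, §3.1 p. 19] -/
theorem star_mul_antidiagTwo_mul_of_mem₂ {g : GL (Fin 2) ℂ} (hg : g ∈ unitaryGroupOfForm (starRingEnd ℂ) J) :
    star (g : Matrix (Fin 2) (Fin 2) ℂ) * !![0, 1; 1, 0] * (g : Matrix (Fin 2) (Fin 2) ℂ) = !![0, 1; 1, 0] := by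
  have h := mem_unitaryGroupOfForm_starRingEnd_iff.1 hg
  rwa [hJ, antidiagTwo_eq'] at h

include hJ in
/-- **`|det g| = 1` on `U(Φ₂)(ℂ)`** (`det(gᴴ) det(Φ₂) det(g) = det(Φ₂)`, `det Φ₂ = −1`). [cite: Rogawski1990, §3.1 p. 19] -/
theorem norm_det_eq_one_of_mem₂ {g : GL (Fin 2) ℂ} (hg : g ∈ unitaryGroupOfForm (starRingEnd ℂ) J) :
    ‖(g : Matrix (Fin 2) (Fin 2) ℂ).det‖ = 1 := by
  have h := congrArg Matrix.det (star_mul_antidiagTwo_mul_of_mem₂ hJ hg)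
  rw [Matrix.det_mul, Matrix.det_mul, Matrix.star_eq_conjTranspose, Matrix.det_conjTranspose] at h
  have hΦ : Matrix.det (!![0, 1; 1, 0] : Matrix (Fin 2) (Fin 2) ℂ) = -1 := by
    rw [Matrix.det_fin_two_of]; ring
  rw [hΦ] at h
  have h1 : star (g : Matrix (Fin 2) (Fin 2) ℂ).det * (g : Matrix (Fin 2) (Fin 2) ℂ).det = 1 := by linear_combination -h
  have h2 : ‖(g : Matrix (Fin 2) (Fin 2) ℂ).det‖ ^ 2 = 1 := by
    rw [← Complex.normSq_eq_norm_sq, ← Complex.ofReal_inj, Complex.ofReal_one, Complex.normSq_eq_conj_mul_self]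
    exact h1
  nlinarith [norm_nonneg (g : Matrix (Fin 2) (Fin 2) ℂ).det]

include hJ in
/-- **The inverse on `U(Φ₂)(ℂ)`**: `g⁻¹ = Φ₂ gᴴ Φ₂`, i.e. `(g⁻¹)₀₀ = conj g₁₁`, `(g⁻¹)₀₁ = conj g₀₁`, `(g⁻¹)₁₀ = conj g₁₀`, `(g⁻¹)₁₁ = conj g₀₀` — so the entries of `g⁻¹`
are bounded by those of `g`. [cite: Rogawski1990, §3.1 p. 19] -/
theorem coe_inv_eq_of_mem₂ {g : GL (Fin 2) ℂ} (hg : g ∈ unitaryGroupOfForm (starRingEnd ℂ) J) :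
    ((g⁻¹ : GL (Fin 2) ℂ) : Matrix (Fin 2) (Fin 2) ℂ) =
      !![conj ((g : Matrix (Fin 2) (Fin 2) ℂ) 1 1), conj ((g : Matrix (Fin 2) (Fin 2) ℂ) 0 1);
         conj ((g : Matrix (Fin 2) (Fin 2) ℂ) 1 0), conj ((g : Matrix (Fin 2) (Fin 2) ℂ) 0 0)] := by
  have h := star_mul_antidiagTwo_mul_of_mem₂ hJ hg
  -- `(Φ₂ gᴴ Φ₂) g = 1`, hence `g⁻¹ = Φ₂ gᴴ Φ₂`
  have hleft : (!![conj ((g : Matrix (Fin 2) (Fin 2) ℂ) 1 1), conj ((g : Matrix (Fin 2) (Fin 2) ℂ) 0 1);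
      conj ((g : Matrix (Fin 2) (Fin 2) ℂ) 1 0), conj ((g : Matrix (Fin 2) (Fin 2) ℂ) 0 0)] : Matrix (Fin 2) (Fin 2) ℂ) * (g : Matrix (Fin 2) (Fin 2) ℂ) = 1 := by
    have hΦ : (!![conj ((g : Matrix (Fin 2) (Fin 2) ℂ) 1 1), conj ((g : Matrix (Fin 2) (Fin 2) ℂ) 0 1);
        conj ((g : Matrix (Fin 2) (Fin 2) ℂ) 1 0), conj ((g : Matrix (Fin 2) (Fin 2) ℂ) 0 0)] : Matrix (Fin 2) (Fin 2) ℂ) =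
        !![0, 1; 1, 0] * (star (g : Matrix (Fin 2) (Fin 2) ℂ) * !![0, 1; 1, 0]) := by
      ext i j
      fin_cases i <;> fin_cases j <;> simp [Matrix.mul_apply, Fin.sum_univ_two, Matrix.star_apply]
    rw [hΦ, Matrix.mul_assoc, Matrix.mul_assoc, ← Matrix.mul_assoc (star (g : Matrix (Fin 2) (Fin 2) ℂ)), h]
    ext i j
    fin_cases i <;> fin_cases j <;> simp [Matrix.mul_apply, Fin.sum_univ_two]
  rw [Matrix.coe_units_inv]
  exact Matrix.inv_eq_left_inv hleft

include hJ in
/-- **MATRIX-BOUNDED SUBSETS OF `U(Φ₂)(ℂ)` ARE COMPACT**: `{g ∈ U(Φ₂)(ℂ) ∣ |g_{ij}| ≤ ρ ∀ i j}` is compact — the entries of `g⁻¹ = Φ₂ gᴴ Φ₂` are then bounded by `ρ` too, and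
`g ↦ (g, g⁻¹)` is a closed embedding of the closed subgroup `U(Φ₂)(ℂ) ≤ GL₂(ℂ)` into `M₂(ℂ) × M₂(ℂ)` (Mathlib `Units.isClosedEmbedding_embedProduct`).  (Properness of the
inclusion, not compactness of the group.) [cite: Rogawski1990, §3.1 p. 19; §8.3 p. 122] [cite: DeitmarEchterhoff2014, Lemma 9.3.3] -/
theorem isCompact_setOf_forall_norm_le₂ (ρ : ℝ) :
    IsCompact {g : ↥(unitaryGroupOfForm (starRingEnd ℂ) J) | ∀ i j, ‖((g : GL (Fin 2) ℂ) : Matrix (Fin 2) (Fin 2) ℂ) i j‖ ≤ ρ} := by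
  -- the compact box of matrices with entries bounded by `ρ`
  have hBox : IsCompact {A : Matrix (Fin 2) (Fin 2) ℂ | ∀ i j, ‖A i j‖ ≤ ρ} := by
    have hEq : {A : Matrix (Fin 2) (Fin 2) ℂ | ∀ i j, ‖A i j‖ ≤ ρ} =
        ((Set.univ.pi fun (_ : Fin 2) => Set.univ.pi fun (_ : Fin 2) => Metric.closedBall (0 : ℂ) ρ) : Set (Matrix (Fin 2) (Fin 2) ℂ)) := by
      ext A
      refine ⟨fun h i _ j _ => ?_, fun h i j => ?_⟩
      · simpa only [Metric.mem_closedBall, dist_zero_right] using h i j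
      · simpa only [Metric.mem_closedBall, dist_zero_right] using h i (Set.mem_univ i) j (Set.mem_univ j)
    rw [hEq]
    exact isCompact_univ_pi fun _ => isCompact_univ_pi fun _ => isCompact_closedBall (0 : ℂ) ρ
  -- the closed embedding `ψ : g ↦ (g, g⁻¹)` of `U(Φ₂)(ℂ)` into `M₂(ℂ) × M₂(ℂ)`
  obtain ⟨ψ, hψdef⟩ : ∃ ψ : ↥(unitaryGroupOfForm (starRingEnd ℂ) J) → Matrix (Fin 2) (Fin 2) ℂ × Matrix (Fin 2) (Fin 2) ℂ,
      ψ = fun g : ↥(unitaryGroupOfForm (starRingEnd ℂ) J) =>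
        ((((g : GL (Fin 2) ℂ) : Matrix (Fin 2) (Fin 2) ℂ)), ((((g : GL (Fin 2) ℂ))⁻¹ : GL (Fin 2) ℂ) : Matrix (Fin 2) (Fin 2) ℂ)) := ⟨_, rfl⟩
  have hψ : IsClosedEmbedding ψ := by
    have h1 : IsClosedEmbedding fun g : ↥(unitaryGroupOfForm (starRingEnd ℂ) J) => (g : GL (Fin 2) ℂ) :=
      (isClosed_unitaryGroupOfForm_complex J).isClosedEmbedding_subtypeVal
    have h2 : IsClosedEmbedding (Units.embedProduct (Matrix (Fin 2) (Fin 2) ℂ)) := Units.isClosedEmbedding_embedProduct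
    rw [hψdef]
    exact ((((Homeomorph.refl (Matrix (Fin 2) (Fin 2) ℂ)).prodCongr (@MulOpposite.opHomeomorph (Matrix (Fin 2) (Fin 2) ℂ) _).symm).isClosedEmbedding).comp h2).comp h1
  -- `{g | |g_{ij}| ≤ ρ}` is closed and lies in the compact `ψ⁻¹(Box × Box)`
  have hsub : {g : ↥(unitaryGroupOfForm (starRingEnd ℂ) J) | ∀ i j, ‖((g : GL (Fin 2) ℂ) : Matrix (Fin 2) (Fin 2) ℂ) i j‖ ≤ ρ} ⊆
      ψ ⁻¹' ({A : Matrix (Fin 2) (Fin 2) ℂ | ∀ i j, ‖A i j‖ ≤ ρ} ×ˢ {A : Matrix (Fin 2) (Fin 2) ℂ | ∀ i j, ‖A i j‖ ≤ ρ}) := by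
    intro g hg
    rw [hψdef]
    refine ⟨hg, fun i j => ?_⟩
    show ‖((((g : GL (Fin 2) ℂ))⁻¹ : GL (Fin 2) ℂ) : Matrix (Fin 2) (Fin 2) ℂ) i j‖ ≤ ρ
    rw [coe_inv_eq_of_mem₂ hJ g.2]
    fin_cases i <;> fin_cases j
    · simpa using hg 1 1
    · simpa using hg 0 1
    · simpa using hg 1 0
    · simpa using hg 0 0
  have hclosed : IsClosed {g : ↥(unitaryGroupOfForm (starRingEnd ℂ) J) | ∀ i j, ‖((g : GL (Fin 2) ℂ) : Matrix (Fin 2) (Fin 2) ℂ) i j‖ ≤ ρ} := by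
    have hc : Continuous fun g : ↥(unitaryGroupOfForm (starRingEnd ℂ) J) => ((g : GL (Fin 2) ℂ) : Matrix (Fin 2) (Fin 2) ℂ) :=
      Units.continuous_val.comp continuous_subtype_val
    have hEq : {g : ↥(unitaryGroupOfForm (starRingEnd ℂ) J) | ∀ i j, ‖((g : GL (Fin 2) ℂ) : Matrix (Fin 2) (Fin 2) ℂ) i j‖ ≤ ρ} =
        ⋂ i, ⋂ j, {g : ↥(unitaryGroupOfForm (starRingEnd ℂ) J) | ‖((g : GL (Fin 2) ℂ) : Matrix (Fin 2) (Fin 2) ℂ) i j‖ ≤ ρ} := by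
      ext g; simp only [Set.mem_setOf_eq, Set.mem_iInter]
    rw [hEq]
    exact isClosed_iInter fun i => isClosed_iInter fun j => isClosed_le ((hc.matrix_elem i j).norm) continuous_const
  exact (hψ.isCompact_preimage (hBox.prod hBox)).of_isClosed_subset hclosed hsub

include hJ in
/-- **The diagonal torus elements `diag(c, c̄⁻¹)` lie in `U(Φ₂)(ℂ)`** (★ `diag_mem_unitary_antidiag_iff` shape: `c̄ · c̄⁻¹ = 1`). [cite: Rogawski1990, §3.1 p. 19; §3.6 p. 31] -/
theorem diagHyp_mem₂ {c : ℂ} (hc : c ≠ 0) (h : Matrix.det !![c, 0; 0, (star c)⁻¹] ≠ 0) :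
    Matrix.GeneralLinearGroup.mkOfDetNeZero !![c, 0; 0, (star c)⁻¹] h ∈ unitaryGroupOfForm (starRingEnd ℂ) J := by
  rw [mem_unitaryGroupOfForm_starRingEnd_iff, Matrix.GeneralLinearGroup.val_mkOfDetNeZero, hJ, antidiagTwo_eq']
  have hsc : (starRingEnd ℂ) c ≠ 0 := (map_ne_zero _).mpr hc
  ext i j
  fin_cases i <;> fin_cases j <;> simp [Matrix.mul_apply, Fin.sum_univ_two, Matrix.star_apply, hsc, hc]

/-- `det diag(c, c̄⁻¹) ≠ 0` for `c ≠ 0`. [cite: Rogawski1990, §3.1 p. 19] -/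
theorem det_diagHyp_ne_zero {c : ℂ} (hc : c ≠ 0) : Matrix.det !![c, 0; 0, (star c)⁻¹] ≠ 0 := by
  rw [Matrix.det_fin_two_of]
  simp [hc]

include hJ in
/-- **The real torus element `diag(r, r⁻¹) ∈ U(Φ₂)(ℂ)` exists** (`r ≠ 0` real; `r̄⁻¹ = r⁻¹`). [cite: Rogawski1990, §3.1 p. 19; §3.6 p. 31] -/
theorem exists_coe_eq_diagReal₂ {r : ℝ} (hr : r ≠ 0) :
    ∃ τ : ↥(unitaryGroupOfForm (starRingEnd ℂ) J), ((τ : GL (Fin 2) ℂ) : Matrix (Fin 2) (Fin 2) ℂ) = !![(r : ℂ), 0; 0, ((r⁻¹ : ℝ) : ℂ)] := by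
  have hrC : (r : ℂ) ≠ 0 := Complex.ofReal_ne_zero.mpr hr
  have hstar : (star (r : ℂ))⁻¹ = ((r⁻¹ : ℝ) : ℂ) := by rw [Complex.star_def, Complex.conj_ofReal, Complex.ofReal_inv]
  exact ⟨⟨Matrix.GeneralLinearGroup.mkOfDetNeZero !![(r : ℂ), 0; 0, (star (r : ℂ))⁻¹] (det_diagHyp_ne_zero hrC), diagHyp_mem₂ hJ hrC _⟩, by
    rw [← hstar]; exact Matrix.GeneralLinearGroup.val_mkOfDetNeZero _ _⟩

end Group

/-! ## §2 The column-balancing lemma -/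

section Balance

/-- `min(u, v) ≤ m` from `u v ≤ m²` (`u, v, m ≥ 0`), and then `max(u, v) ≤ m + 1` from `|u − v| ≤ 1`. [folklore] -/
private theorem le_add_one_of_mul_le_sq {u v m : ℝ} (hu : 0 ≤ u) (hv : 0 ≤ v) (hm : 0 ≤ m) (huv : u * v ≤ m ^ 2) (h1 : u ≤ v + 1) (h2 : v ≤ u + 1) :
    u ≤ m + 1 ∧ v ≤ m + 1 := by
  rcases le_total u v with h | h
  · have hu' : u ≤ m := by nlinarith [mul_le_mul h le_rfl hu hv]
    exact ⟨by linarith, by linarith⟩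
  · have hv' : v ≤ m := by nlinarith [mul_le_mul le_rfl h hv hu]
    exact ⟨by linarith, by linarith⟩

variable {J : Matrix (Fin 2) (Fin 2) ℂ} (hJ : J = Matrix.of fun i j : Fin 2 => if i.val + j.val + 1 = 2 then (1 : ℂ) else 0)

set_option maxHeartbeats 400000 in
include hJ in
/-- **THE COLUMN-BALANCING LEMMA.**  Let `y ∈ U(Φ₂)(ℂ)`, `t ∈ U(Φ₂)(ℂ)` with matrix `diag(a, ā⁻¹)`, `|a| ≠ 1`, and suppose every entry of `y t y⁻¹` has norm `≤ ρ` (`ρ ≥ 0`).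
Put `m := ρ ∕ |a − ā⁻¹|`.  Then there is `r > 0` REAL such that for the torus element `τ = diag(r, r⁻¹) ∈ U(Φ₂)(ℂ)` (stated for EVERY `τ` with that matrix, so that consumers
may supply `τ` in their own subtype spelling, e.g. `hypBlockGL (log r) 0` of the ★ atlas; existence: `exists_coe_eq_diagReal₂`) every entry of `y τ` has norm
`≤ √(√(2m² + 2(m+1)²))`.
PROOF: the off-diagonal entries of `y t y⁻¹` are `(ā⁻¹ − a) y₀₀y₀₁ ∕ det y` and `(a − ā⁻¹) y₁₀y₁₁ ∕ det y` with `|det y| = 1`, so `|y₀₀y₀₁|, |y₁₀y₁₁| ≤ m`;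
`|y₀₀y₁₁ − y₀₁y₁₀| = 1` and `|y₀₀y₁₁|·|y₀₁y₁₀| ≤ m²` give `|y₀₀y₁₁|, |y₀₁y₁₀| ≤ m + 1`; hence the product of the two squared column norms is `≤ 2m² + 2(m+1)²`, and `τ`
with `c² = N₂ ∕ N₁` equalises the two column norms at `√(N₁N₂)`. [cite: Rogawski1990, §3.1 p. 19; §8.3 p. 122] [cite: Shelstad1979, §4 p. 22] [cite: Knapp1986, Ch. V §3] -/
theorem exists_diag_mul_forall_norm_le₂ (y t : ↥(unitaryGroupOfForm (starRingEnd ℂ) J)) {a : ℂ}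
    (ht : ((t : GL (Fin 2) ℂ) : Matrix (Fin 2) (Fin 2) ℂ) = !![a, 0; 0, (star a)⁻¹]) (ha1 : ‖a‖ ≠ 1) {ρ : ℝ} (hρ : 0 ≤ ρ)
    (hyt : ∀ i j, ‖(((y * t * y⁻¹ : ↥(unitaryGroupOfForm (starRingEnd ℂ) J)) : GL (Fin 2) ℂ) : Matrix (Fin 2) (Fin 2) ℂ) i j‖ ≤ ρ) :
    ∃ r : ℝ, 0 < r ∧ ∀ τ : ↥(unitaryGroupOfForm (starRingEnd ℂ) J),
      ((τ : GL (Fin 2) ℂ) : Matrix (Fin 2) (Fin 2) ℂ) = !![(r : ℂ), 0; 0, ((r⁻¹ : ℝ) : ℂ)] →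
        ∀ i j, ‖(((y * τ : ↥(unitaryGroupOfForm (starRingEnd ℂ) J)) : GL (Fin 2) ℂ) : Matrix (Fin 2) (Fin 2) ℂ) i j‖ ≤
          Real.sqrt (Real.sqrt (2 * (ρ / ‖a - (star a)⁻¹‖) ^ 2 + 2 * (ρ / ‖a - (star a)⁻¹‖ + 1) ^ 2)) := by
  -- names for the entries of `y`
  set p : ℂ := ((y : GL (Fin 2) ℂ) : Matrix (Fin 2) (Fin 2) ℂ) 0 0 with hp
  set q : ℂ := ((y : GL (Fin 2) ℂ) : Matrix (Fin 2) (Fin 2) ℂ) 0 1 with hq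
  set r : ℂ := ((y : GL (Fin 2) ℂ) : Matrix (Fin 2) (Fin 2) ℂ) 1 0 with hr
  set s : ℂ := ((y : GL (Fin 2) ℂ) : Matrix (Fin 2) (Fin 2) ℂ) 1 1 with hs
  set m : ℝ := ρ / ‖a - (star a)⁻¹‖ with hm
  have hyM : ((y : GL (Fin 2) ℂ) : Matrix (Fin 2) (Fin 2) ℂ) = !![p, q; r, s] := by
    ext i j; fin_cases i <;> fin_cases j <;> rfl
  -- `a ≠ 0` (else `t` is not invertible) and `a ≠ ā⁻¹` (regularity)
  have ha0 : a ≠ 0 := by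
    intro h0
    have hdet : (((t : GL (Fin 2) ℂ) : Matrix (Fin 2) (Fin 2) ℂ)).det ≠ 0 := by
      rw [← Matrix.GeneralLinearGroup.val_det_apply]; exact Units.ne_zero _
    apply hdet
    rw [ht, h0, Matrix.det_fin_two_of]
    simp
  have hδ : 0 < ‖a - (star a)⁻¹‖ := by
    rw [norm_pos_iff, sub_ne_zero]
    intro h
    apply ha1
    have h2 : a * star a = 1 := by
      have h' : a * star a = (star a)⁻¹ * star a := congrArg (· * star a) h
      rw [h', inv_mul_cancel₀ (star_ne_zero.mpr ha0)]
    have h3 : ‖a‖ ^ 2 = 1 := by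
      rw [← Complex.normSq_eq_norm_sq, ← Complex.ofReal_inj, Complex.ofReal_one, Complex.normSq_eq_conj_mul_self, mul_comm]
      exact h2
    nlinarith [norm_nonneg a]
  have hm0 : 0 ≤ m := div_nonneg hρ hδ.le
  -- `|det y| = 1`
  have hdet1 : ‖p * s - q * r‖ = 1 := by
    have h := norm_det_eq_one_of_mem₂ hJ y.2
    rwa [hyM, Matrix.det_fin_two_of] at h
  have hdet0 : p * s - q * r ≠ 0 := by
    intro h; rw [h, norm_zero] at hdet1; exact zero_ne_one hdet1
  -- the conjugate `y t y⁻¹` as a matrix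
  have hconj : (((y * t * y⁻¹ : ↥(unitaryGroupOfForm (starRingEnd ℂ) J)) : GL (Fin 2) ℂ) : Matrix (Fin 2) (Fin 2) ℂ) =
      (p * s - q * r)⁻¹ • !![a * p * s - (star a)⁻¹ * q * r, ((star a)⁻¹ - a) * p * q; (a - (star a)⁻¹) * r * s, (star a)⁻¹ * p * s - a * q * r] := by
    have hinv : (((y⁻¹ : ↥(unitaryGroupOfForm (starRingEnd ℂ) J)) : GL (Fin 2) ℂ) : Matrix (Fin 2) (Fin 2) ℂ) = (p * s - q * r)⁻¹ • !![s, -q; -r, p] := by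
      rw [Subgroup.coe_inv, Matrix.coe_units_inv, hyM, Matrix.inv_def, Matrix.det_fin_two_of, Matrix.adjugate_fin_two_of, Ring.inverse_eq_inv']
    rw [Subgroup.coe_mul, Subgroup.coe_mul, Units.val_mul, Units.val_mul, hinv, hyM, ht, Matrix.mul_smul]
    congr 1
    ext i j
    fin_cases i <;> fin_cases j <;> simp [Matrix.mul_apply, Fin.sum_univ_two] <;> ring
  -- `|pq| ≤ m`, `|rs| ≤ m`
  have hnorminv : ‖(p * s - q * r)⁻¹‖ = 1 := by rw [norm_inv, hdet1, inv_one]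
  have hpq : ‖p‖ * ‖q‖ ≤ m := by
    have h := hyt 0 1
    rw [hconj, Matrix.smul_apply, smul_eq_mul, norm_mul, hnorminv, one_mul] at h
    simp only [Matrix.of_apply, Matrix.cons_val', Matrix.cons_val_zero, Matrix.cons_val_one, Matrix.empty_val', Matrix.cons_val_fin_one] at h
    rw [norm_mul, norm_mul, show ‖(star a)⁻¹ - a‖ = ‖a - (star a)⁻¹‖ from norm_sub_rev _ _] at h
    rw [hm, le_div_iff₀ hδ]
    nlinarith [norm_nonneg p, norm_nonneg q]
  have hrs : ‖r‖ * ‖s‖ ≤ m := by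
    have h := hyt 1 0
    rw [hconj, Matrix.smul_apply, smul_eq_mul, norm_mul, hnorminv, one_mul] at h
    simp only [Matrix.of_apply, Matrix.cons_val', Matrix.cons_val_zero, Matrix.cons_val_one, Matrix.empty_val', Matrix.cons_val_fin_one] at h
    rw [norm_mul, norm_mul] at h
    rw [hm, le_div_iff₀ hδ]
    nlinarith [norm_nonneg r, norm_nonneg s]
  -- `|ps|, |qr| ≤ m + 1`
  have hps_qr : ‖p‖ * ‖s‖ ≤ m + 1 ∧ ‖q‖ * ‖r‖ ≤ m + 1 := by
    refine le_add_one_of_mul_le_sq (mul_nonneg (norm_nonneg _) (norm_nonneg _)) (mul_nonneg (norm_nonneg _) (norm_nonneg _)) hm0 ?_ ?_ ?_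
    · calc ‖p‖ * ‖s‖ * (‖q‖ * ‖r‖) = (‖p‖ * ‖q‖) * (‖r‖ * ‖s‖) := by ring
        _ ≤ m * m := mul_le_mul hpq hrs (mul_nonneg (norm_nonneg _) (norm_nonneg _)) hm0
        _ = m ^ 2 := (sq m).symm
    · have h := norm_sub_le (p * s - q * r) (-(q * r))
      rw [sub_neg_eq_add, sub_add_cancel, norm_mul, hdet1, norm_neg, norm_mul] at h
      linarith
    · have h := norm_sub_le (p * s) (p * s - q * r)
      rw [sub_sub_cancel, norm_mul, norm_mul, hdet1] at h
      linarith
  obtain ⟨hps, hqr⟩ := hps_qr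
  -- the two column norms
  set N₁ : ℝ := ‖p‖ ^ 2 + ‖r‖ ^ 2 with hN₁
  set N₂ : ℝ := ‖q‖ ^ 2 + ‖s‖ ^ 2 with hN₂
  have hprod : N₁ * N₂ ≤ 2 * m ^ 2 + 2 * (m + 1) ^ 2 := by
    have e : N₁ * N₂ = (‖p‖ * ‖q‖) ^ 2 + (‖p‖ * ‖s‖) ^ 2 + (‖q‖ * ‖r‖) ^ 2 + (‖r‖ * ‖s‖) ^ 2 := by rw [hN₁, hN₂]; ring
    rw [e]
    have h1 := pow_le_pow_left₀ (mul_nonneg (norm_nonneg p) (norm_nonneg q)) hpq 2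
    have h2 := pow_le_pow_left₀ (mul_nonneg (norm_nonneg p) (norm_nonneg s)) hps 2
    have h3 := pow_le_pow_left₀ (mul_nonneg (norm_nonneg q) (norm_nonneg r)) hqr 2
    have h4 := pow_le_pow_left₀ (mul_nonneg (norm_nonneg r) (norm_nonneg s)) hrs 2
    linarith
  -- both columns are non-zero (`det y ≠ 0`)
  have hN₁0 : 0 < N₁ := by
    rw [hN₁]
    by_contra hle
    have h0 : ‖p‖ ^ 2 + ‖r‖ ^ 2 = 0 := le_antisymm (not_lt.mp hle) (by positivity)
    have hp2 : ‖p‖ ^ 2 = 0 := by nlinarith [sq_nonneg ‖p‖, sq_nonneg ‖r‖]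
    have hr2 : ‖r‖ ^ 2 = 0 := by nlinarith [sq_nonneg ‖p‖, sq_nonneg ‖r‖]
    have hp0 : p = 0 := norm_eq_zero.mp (pow_eq_zero_iff two_ne_zero |>.mp hp2)
    have hr0 : r = 0 := norm_eq_zero.mp (pow_eq_zero_iff two_ne_zero |>.mp hr2)
    exact hdet0 (by rw [hp0, hr0]; ring)
  have hN₂0 : 0 < N₂ := by
    rw [hN₂]
    by_contra hle
    have h0 : ‖q‖ ^ 2 + ‖s‖ ^ 2 = 0 := le_antisymm (not_lt.mp hle) (by positivity)
    have hq2 : ‖q‖ ^ 2 = 0 := by nlinarith [sq_nonneg ‖q‖, sq_nonneg ‖s‖]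
    have hs2 : ‖s‖ ^ 2 = 0 := by nlinarith [sq_nonneg ‖q‖, sq_nonneg ‖s‖]
    have hq0 : q = 0 := norm_eq_zero.mp (pow_eq_zero_iff two_ne_zero |>.mp hq2)
    have hs0 : s = 0 := norm_eq_zero.mp (pow_eq_zero_iff two_ne_zero |>.mp hs2)
    exact hdet0 (by rw [hq0, hs0]; ring)
  -- the balancing parameter `c > 0`, `c ^ 4 = N₂ / N₁`
  set c : ℝ := Real.sqrt (Real.sqrt (N₂ / N₁)) with hc
  have hc0 : 0 < c := Real.sqrt_pos.mpr (Real.sqrt_pos.mpr (div_pos hN₂0 hN₁0))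
  have hc2 : c ^ 2 = Real.sqrt (N₂ / N₁) := by rw [hc, Real.sq_sqrt (Real.sqrt_nonneg _)]
  have hc4 : c ^ 2 * c ^ 2 = N₂ / N₁ := by rw [hc2, Real.mul_self_sqrt (div_pos hN₂0 hN₁0).le]
  -- the torus element `τ = diag(c, c⁻¹)`: only its matrix is used
  refine ⟨c, hc0, fun τ hτM => ?_⟩
  -- the entries of `y τ`
  have hyτ : (((y * τ : ↥(unitaryGroupOfForm (starRingEnd ℂ) J)) : GL (Fin 2) ℂ) : Matrix (Fin 2) (Fin 2) ℂ) =
      !![p * (c : ℂ), q * ((c⁻¹ : ℝ) : ℂ); r * (c : ℂ), s * ((c⁻¹ : ℝ) : ℂ)] := by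
    rw [Subgroup.coe_mul, Units.val_mul, hyM, hτM]
    ext i j
    fin_cases i <;> fin_cases j <;> simp [Matrix.mul_apply, Fin.sum_univ_two]
  -- the squared column norms of `y τ` both equal `√(N₁ N₂) ≤ √(2m² + 2(m+1)²)`
  have hN₁sq : N₁ * Real.sqrt (N₂ / N₁) = Real.sqrt (N₁ * N₂) := by
    have hs : Real.sqrt (N₁ ^ 2) = N₁ := Real.sqrt_sq hN₁0.le
    calc N₁ * Real.sqrt (N₂ / N₁) = Real.sqrt (N₁ ^ 2) * Real.sqrt (N₂ / N₁) := by rw [hs]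
      _ = Real.sqrt (N₁ ^ 2 * (N₂ / N₁)) := (Real.sqrt_mul (sq_nonneg _) _).symm
      _ = Real.sqrt (N₁ * N₂) := by
          congr 1
          rw [sq, mul_assoc, mul_div_cancel₀ _ hN₁0.ne']
  have hcol1 : (‖p‖ * c) ^ 2 + (‖r‖ * c) ^ 2 = Real.sqrt (N₁ * N₂) := by
    have e1 : (‖p‖ * c) ^ 2 + (‖r‖ * c) ^ 2 = N₁ * c ^ 2 := by rw [hN₁]; ring
    rw [e1, hc2, hN₁sq]
  have hcol2 : (‖q‖ * c⁻¹) ^ 2 + (‖s‖ * c⁻¹) ^ 2 = Real.sqrt (N₁ * N₂) := by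
    have hc20 : c ^ 2 ≠ 0 := pow_ne_zero _ hc0.ne'
    have e1 : (‖q‖ * c⁻¹) ^ 2 + (‖s‖ * c⁻¹) ^ 2 = N₂ / c ^ 2 := by rw [hN₂]; field_simp
    have e2 : N₂ / c ^ 2 = N₁ * c ^ 2 := by
      rw [div_eq_iff hc20]
      have : N₁ * c ^ 2 * c ^ 2 = N₁ * (N₂ / N₁) := by rw [mul_assoc, hc4]
      rw [this, mul_div_cancel₀ _ hN₁0.ne']
    rw [e1, e2, hc2, hN₁sq]
  have hsqrt : Real.sqrt (N₁ * N₂) ≤ Real.sqrt (2 * m ^ 2 + 2 * (m + 1) ^ 2) := Real.sqrt_le_sqrt hprod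
  have hcn : ‖(c : ℂ)‖ = c := by rw [Complex.norm_real, Real.norm_of_nonneg hc0.le]
  have hcin : ‖((c⁻¹ : ℝ) : ℂ)‖ = c⁻¹ := by rw [Complex.norm_real, Real.norm_of_nonneg (inv_pos.mpr hc0).le]
  rw [hyτ]
  refine Fin.forall_fin_two.2 ⟨Fin.forall_fin_two.2 ⟨?_, ?_⟩, Fin.forall_fin_two.2 ⟨?_, ?_⟩⟩
  · show ‖p * (c : ℂ)‖ ≤ _
    rw [norm_mul, hcn]
    exact Real.le_sqrt_of_sq_le (by linarith only [sq_nonneg (‖r‖ * c), hcol1, hsqrt])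
  · show ‖q * ((c⁻¹ : ℝ) : ℂ)‖ ≤ _
    rw [norm_mul, hcin]
    exact Real.le_sqrt_of_sq_le (by linarith only [sq_nonneg (‖s‖ * c⁻¹), hcol2, hsqrt])
  · show ‖r * (c : ℂ)‖ ≤ _
    rw [norm_mul, hcn]
    exact Real.le_sqrt_of_sq_le (by linarith only [sq_nonneg (‖p‖ * c), hcol1, hsqrt])
  · show ‖s * ((c⁻¹ : ℝ) : ℂ)‖ ≤ _
    rw [norm_mul, hcin]
    exact Real.le_sqrt_of_sq_le (by linarith only [sq_nonneg (‖q‖ * c⁻¹), hcol2, hsqrt])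

end Balance

/-! ## §3 (HYP) Uniform properness modulo any subgroup containing the diagonal torus -/

section Proper

variable {J : Matrix (Fin 2) (Fin 2) ℂ} (hJ : J = Matrix.of fun i j : Fin 2 => if i.val + j.val + 1 = 2 then (1 : ℂ) else 0)

/-- The entries of the elements of a compact `C ⊆ U(Φ₂)(ℂ)` are uniformly bounded (by a non-negative constant). [folklore] [cite: DeitmarEchterhoff2014, Lemma 9.3.3] -/
theorem exists_forall_norm_apply_le_of_isCompact₂ {C : Set ↥(unitaryGroupOfForm (starRingEnd ℂ) J)} (hC : IsCompact C) :
    ∃ ρ : ℝ, 0 ≤ ρ ∧ ∀ g ∈ C, ∀ i j, ‖((g : GL (Fin 2) ℂ) : Matrix (Fin 2) (Fin 2) ℂ) i j‖ ≤ ρ := by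
  have hcoe : Continuous fun g : ↥(unitaryGroupOfForm (starRingEnd ℂ) J) => ((g : GL (Fin 2) ℂ) : Matrix (Fin 2) (Fin 2) ℂ) :=
    Units.continuous_val.comp continuous_subtype_val
  have hsum : Continuous fun g : ↥(unitaryGroupOfForm (starRingEnd ℂ) J) => ∑ i, ∑ j, ‖((g : GL (Fin 2) ℂ) : Matrix (Fin 2) (Fin 2) ℂ) i j‖ :=
    continuous_finsetSum _ fun i _ => continuous_finsetSum _ fun j _ => (hcoe.matrix_elem i j).norm
  obtain ⟨ρ₀, hρ₀⟩ := hC.exists_bound_of_continuousOn hsum.continuousOn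
  refine ⟨max ρ₀ 0, le_max_right _ _, fun g hg i j => ?_⟩
  have h1 : ‖((g : GL (Fin 2) ℂ) : Matrix (Fin 2) (Fin 2) ℂ) i j‖ ≤ ∑ j', ‖((g : GL (Fin 2) ℂ) : Matrix (Fin 2) (Fin 2) ℂ) i j'‖ :=
    Finset.single_le_sum (f := fun j' => ‖((g : GL (Fin 2) ℂ) : Matrix (Fin 2) (Fin 2) ℂ) i j'‖) (fun _ _ => norm_nonneg _) (Finset.mem_univ j)
  have h2 : ∑ j', ‖((g : GL (Fin 2) ℂ) : Matrix (Fin 2) (Fin 2) ℂ) i j'‖ ≤ ∑ i', ∑ j', ‖((g : GL (Fin 2) ℂ) : Matrix (Fin 2) (Fin 2) ℂ) i' j'‖ :=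
    Finset.single_le_sum (f := fun i' => ∑ j', ‖((g : GL (Fin 2) ℂ) : Matrix (Fin 2) (Fin 2) ℂ) i' j'‖) (fun _ _ => Finset.sum_nonneg fun _ _ => norm_nonneg _) (Finset.mem_univ i)
  have h3 := hρ₀ g hg
  rw [Real.norm_of_nonneg (Finset.sum_nonneg fun _ _ => Finset.sum_nonneg fun _ _ => norm_nonneg _)] at h3
  exact h1.trans (h2.trans (h3.trans (le_max_left _ _)))

include hJ in
/-- **GROUP-LEVEL TRANSLATE FORM — after a torus translate, the conjugating elements lie in ONE compact subset of `U(Φ₂)(ℂ)`.**  Let `c : X → U(Φ₂)(ℂ)` be a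
continuous chart with diagonal values `diag(a(x), ā(x)⁻¹)`.  For every compact `K ⊆ {x ∣ |a(x)| ≠ 1}` and compact `C ⊆ U(Φ₂)(ℂ)` there is a compact `B ⊆ U(Φ₂)(ℂ)`
such that whenever `y · c(x) · y⁻¹ ∈ C` for some `x ∈ K`, some translate `y · diag(r, r⁻¹)` (`r > 0` real) lies in `B` (§2; the balancing constant `ρ ∕ |a − ā⁻¹|` is
bounded on `K` by continuity).  This is the form the PLACES ASSEMBLY of «(W1-cont-H)» consumes (the global quotient is by the chart torus of `H_∞`, not per place).
[cite: Rogawski1990, §3.1 p. 19; §8.3 p. 122] [cite: Shelstad1979, §4 p. 22] [cite: DeitmarEchterhoff2014, Lemma 9.3.3] -/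
theorem exists_isCompact_forall_exists_mul_diag_mem₂ {X : Type*} [TopologicalSpace X]
    {c : X → ↥(unitaryGroupOfForm (starRingEnd ℂ) J)} (hc : Continuous c) (a : X → ℂ)
    (hca : ∀ x, ((c x : GL (Fin 2) ℂ) : Matrix (Fin 2) (Fin 2) ℂ) = !![a x, 0; 0, (star (a x))⁻¹]) :
    ∀ K ⊆ {x | ‖a x‖ ≠ 1}, IsCompact K → ∀ C : Set ↥(unitaryGroupOfForm (starRingEnd ℂ) J), IsCompact C →
      ∃ B : Set ↥(unitaryGroupOfForm (starRingEnd ℂ) J), IsCompact B ∧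
        ∀ x ∈ K, ∀ y : ↥(unitaryGroupOfForm (starRingEnd ℂ) J), y * c x * y⁻¹ ∈ C →
          ∃ r : ℝ, 0 < r ∧ ∀ τ : ↥(unitaryGroupOfForm (starRingEnd ℂ) J),
            ((τ : GL (Fin 2) ℂ) : Matrix (Fin 2) (Fin 2) ℂ) = !![(r : ℂ), 0; 0, ((r⁻¹ : ℝ) : ℂ)] → y * τ ∈ B := by
  intro K hKS hK C hC
  obtain ⟨ρ, hρ, hent⟩ := exists_forall_norm_apply_le_of_isCompact₂ hC
  -- `a` is continuous and `a(x) ≠ 0`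
  have hcoe : Continuous fun g : ↥(unitaryGroupOfForm (starRingEnd ℂ) J) => ((g : GL (Fin 2) ℂ) : Matrix (Fin 2) (Fin 2) ℂ) :=
    Units.continuous_val.comp continuous_subtype_val
  have ha : Continuous a := by
    have h : a = fun x => ((c x : GL (Fin 2) ℂ) : Matrix (Fin 2) (Fin 2) ℂ) 0 0 := by
      funext x; rw [hca x]; rfl
    rw [h]
    exact (hcoe.comp hc).matrix_elem 0 0
  have ha0 : ∀ x, a x ≠ 0 := by
    intro x h0
    have hdet : (((c x : GL (Fin 2) ℂ) : Matrix (Fin 2) (Fin 2) ℂ)).det ≠ 0 := by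
      rw [← Matrix.GeneralLinearGroup.val_det_apply]; exact Units.ne_zero _
    apply hdet
    rw [hca x, h0, Matrix.det_fin_two_of]
    simp
  -- the gap `δ(x) = |a(x) − ā(x)⁻¹|` is positive on `K`, so `δ⁻¹` is bounded there
  have hδ : ∀ x ∈ K, 0 < ‖a x - (star (a x))⁻¹‖ := by
    intro x hx
    rw [norm_pos_iff, sub_ne_zero]
    intro h
    apply hKS hx
    have h2 : a x * star (a x) = 1 := by
      have h' : a x * star (a x) = (star (a x))⁻¹ * star (a x) := congrArg (· * star (a x)) h
      rw [h', inv_mul_cancel₀ (star_ne_zero.mpr (ha0 x))]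
    have h3 : ‖a x‖ ^ 2 = 1 := by
      rw [← Complex.normSq_eq_norm_sq, ← Complex.ofReal_inj, Complex.ofReal_one, Complex.normSq_eq_conj_mul_self, mul_comm]
      exact h2
    nlinarith [norm_nonneg (a x)]
  have hδcont : ContinuousOn (fun x => ‖a x - (star (a x))⁻¹‖⁻¹) K := by
    refine ContinuousOn.inv₀ ?_ fun x hx => (hδ x hx).ne'
    refine ((ha.continuousOn).sub ?_).norm
    exact (ha.star.continuousOn).inv₀ fun x _ => star_ne_zero.mpr (ha0 x)
  obtain ⟨D, hD⟩ := hK.exists_bound_of_continuousOn hδcont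
  -- the compact set
  set B : ℝ := Real.sqrt (Real.sqrt (2 * (ρ * D) ^ 2 + 2 * (ρ * D + 1) ^ 2)) with hB
  refine ⟨{g : ↥(unitaryGroupOfForm (starRingEnd ℂ) J) | ∀ i j, ‖((g : GL (Fin 2) ℂ) : Matrix (Fin 2) (Fin 2) ℂ) i j‖ ≤ B},
    isCompact_setOf_forall_norm_le₂ hJ B, fun x hx y hy => ?_⟩
  obtain ⟨r, hr, hyτ⟩ := exists_diag_mul_forall_norm_le₂ hJ y (c x) (hca x) (hKS hx) hρ (fun i j => hent _ hy i j)
  -- `ρ ∕ δ(x) ≤ ρ D`, so the bound of §2 at `x` is at most `B`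
  have hmD : ρ / ‖a x - (star (a x))⁻¹‖ ≤ ρ * D := by
    rw [div_eq_mul_inv]
    have h1 := hD x hx
    rw [Real.norm_of_nonneg (inv_nonneg.mpr (norm_nonneg _))] at h1
    exact mul_le_mul_of_nonneg_left h1 hρ
  have hm0 : 0 ≤ ρ / ‖a x - (star (a x))⁻¹‖ := div_nonneg hρ (norm_nonneg _)
  have hle : Real.sqrt (Real.sqrt (2 * (ρ / ‖a x - (star (a x))⁻¹‖) ^ 2 + 2 * (ρ / ‖a x - (star (a x))⁻¹‖ + 1) ^ 2)) ≤ B := by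
    rw [hB]
    exact Real.sqrt_le_sqrt (Real.sqrt_le_sqrt (by nlinarith [hmD, hm0]))
  exact ⟨r, hr, fun τ hτM i j => (hyτ τ hτM i j).trans hle⟩

include hJ in
/-- **(HYP) — THE DIAGONAL CHART OF `U(Φ₂)(ℂ)` IS UNIFORMLY PROPER ON ITS REGULAR SET, MODULO ANY SUBGROUP CONTAINING THE DIAGONAL TORUS.**  Let `c : X → U(Φ₂)(ℂ)` be a
continuous chart with diagonal values `diag(a(x), ā(x)⁻¹)` and `M ≤ U(Φ₂)(ℂ)` a subgroup containing every diagonal element.  Then for every compact `K ⊆ {x ∣ |a(x)| ≠ 1}`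
and compact `C ⊆ U(Φ₂)(ℂ)` there is a compact `𝒦 ⊆ U(Φ₂)(ℂ) ⧸ M` with `y M ∈ 𝒦` whenever `y · c(x) · y⁻¹ ∈ C` for some `x ∈ K` — the (HYP) binder of
★ `continuousOn_integral_descConj_of_uniformlyProper` (the image of the translate form's `B` in the quotient).
[cite: Rogawski1990, §3.1 p. 19; §8.3 p. 122] [cite: Shelstad1979, §4 p. 22] [cite: DeitmarEchterhoff2014, Lemma 9.3.3] -/
theorem uniformlyProper_of_coe_eq_diagHyp₂ {X : Type*} [TopologicalSpace X]
    {c : X → ↥(unitaryGroupOfForm (starRingEnd ℂ) J)} (hc : Continuous c) (a : X → ℂ)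
    (hca : ∀ x, ((c x : GL (Fin 2) ℂ) : Matrix (Fin 2) (Fin 2) ℂ) = !![a x, 0; 0, (star (a x))⁻¹])
    (M : Subgroup ↥(unitaryGroupOfForm (starRingEnd ℂ) J))
    (hM : ∀ τ : ↥(unitaryGroupOfForm (starRingEnd ℂ) J),
      ((τ : GL (Fin 2) ℂ) : Matrix (Fin 2) (Fin 2) ℂ) 0 1 = 0 → ((τ : GL (Fin 2) ℂ) : Matrix (Fin 2) (Fin 2) ℂ) 1 0 = 0 → τ ∈ M) :
    ∀ K ⊆ {x | ‖a x‖ ≠ 1}, IsCompact K → ∀ C : Set ↥(unitaryGroupOfForm (starRingEnd ℂ) J), IsCompact C →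
      ∃ 𝒦 : Set (↥(unitaryGroupOfForm (starRingEnd ℂ) J) ⧸ M), IsCompact 𝒦 ∧
        ∀ x ∈ K, ∀ y : ↥(unitaryGroupOfForm (starRingEnd ℂ) J), y * c x * y⁻¹ ∈ C →
          (QuotientGroup.mk y : ↥(unitaryGroupOfForm (starRingEnd ℂ) J) ⧸ M) ∈ 𝒦 := by
  intro K hKS hK C hC
  obtain ⟨B, hB, hmem⟩ := exists_isCompact_forall_exists_mul_diag_mem₂ hJ hc a hca K hKS hK C hC
  refine ⟨QuotientGroup.mk '' B, hB.image continuous_quotient_mk', fun x hx y hy => ?_⟩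
  obtain ⟨r, hr, hyτ⟩ := hmem x hx y hy
  obtain ⟨τ, hτM⟩ := exists_coe_eq_diagReal₂ hJ hr.ne'
  have hτ01 : ((τ : GL (Fin 2) ℂ) : Matrix (Fin 2) (Fin 2) ℂ) 0 1 = 0 := by rw [hτM]; rfl
  have hτ10 : ((τ : GL (Fin 2) ℂ) : Matrix (Fin 2) (Fin 2) ℂ) 1 0 = 0 := by rw [hτM]; rfl
  refine ⟨y * τ, hyτ τ hτM, ?_⟩
  rw [QuotientGroup.eq, mul_inv_rev, inv_mul_cancel_right]
  exact M.inv_mem (hM τ hτ01 hτ10)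

/-- **Diagonal elements centralise a diagonal element**: if `γ₁ ∈ U(Φ₂)(ℂ)` has matrix `diag(a₁, ā₁⁻¹)` then every `τ ∈ U(Φ₂)(ℂ)` with `τ₀₁ = τ₁₀ = 0` lies in `Z(γ₁)` — so
`M := Z(γ₁)` (the split Cartan when `|a₁| ≠ 1`) is admissible in `uniformlyProper_of_coe_eq_diagHyp₂`. [cite: Rogawski1990, §3.1 p. 19; §3.6 p. 31] -/
theorem mem_centralizer_of_apply_eq_zero₂ {γ₁ τ : ↥(unitaryGroupOfForm (starRingEnd ℂ) J)} {a₁ : ℂ}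
    (hγ₁ : ((γ₁ : GL (Fin 2) ℂ) : Matrix (Fin 2) (Fin 2) ℂ) = !![a₁, 0; 0, (star a₁)⁻¹])
    (h01 : ((τ : GL (Fin 2) ℂ) : Matrix (Fin 2) (Fin 2) ℂ) 0 1 = 0) (h10 : ((τ : GL (Fin 2) ℂ) : Matrix (Fin 2) (Fin 2) ℂ) 1 0 = 0) :
    τ ∈ Subgroup.centralizer ({γ₁} : Set ↥(unitaryGroupOfForm (starRingEnd ℂ) J)) := by
  rw [Subgroup.mem_centralizer_iff]
  intro g hg
  rw [Set.mem_singleton_iff] at hg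
  rw [hg]
  have hτM : ((τ : GL (Fin 2) ℂ) : Matrix (Fin 2) (Fin 2) ℂ) =
      !![((τ : GL (Fin 2) ℂ) : Matrix (Fin 2) (Fin 2) ℂ) 0 0, 0; 0, ((τ : GL (Fin 2) ℂ) : Matrix (Fin 2) (Fin 2) ℂ) 1 1] := by
    ext i j
    fin_cases i <;> fin_cases j
    · rfl
    · exact h01
    · exact h10
    · rfl
  apply Subtype.ext
  apply Units.ext
  show ((γ₁ : GL (Fin 2) ℂ) : Matrix (Fin 2) (Fin 2) ℂ) * ((τ : GL (Fin 2) ℂ) : Matrix (Fin 2) (Fin 2) ℂ) =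
    ((τ : GL (Fin 2) ℂ) : Matrix (Fin 2) (Fin 2) ℂ) * ((γ₁ : GL (Fin 2) ℂ) : Matrix (Fin 2) (Fin 2) ℂ)
  rw [hγ₁, hτM]
  ext i j
  fin_cases i <;> fin_cases j <;> simp [Matrix.mul_apply, Fin.sum_univ_two] <;> ring

include hJ in
/-- **(HYP) MODULO THE SPLIT CARTAN `Z(γ₁)`** (`γ₁ = diag(a₁, ā₁⁻¹)`): the instance of `uniformlyProper_of_coe_eq_diagHyp₂` at `M := Z(γ₁)` — the rank-one twin of
★ `uniformlyProper_centralizer_of_diag_hyperbolic` (`U(2,1)`), in chart form. [cite: Rogawski1990, §3.6 p. 31; §8.3 p. 122] [cite: Shelstad1979, §4 p. 22]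
[cite: DeitmarEchterhoff2014, Lemma 9.3.3] -/
theorem uniformlyProper_centralizer_of_coe_eq_diagHyp₂ {X : Type*} [TopologicalSpace X]
    {c : X → ↥(unitaryGroupOfForm (starRingEnd ℂ) J)} (hc : Continuous c) (a : X → ℂ)
    (hca : ∀ x, ((c x : GL (Fin 2) ℂ) : Matrix (Fin 2) (Fin 2) ℂ) = !![a x, 0; 0, (star (a x))⁻¹])
    {γ₁ : ↥(unitaryGroupOfForm (starRingEnd ℂ) J)} {a₁ : ℂ} (hγ₁ : ((γ₁ : GL (Fin 2) ℂ) : Matrix (Fin 2) (Fin 2) ℂ) = !![a₁, 0; 0, (star a₁)⁻¹]) :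
    ∀ K ⊆ {x | ‖a x‖ ≠ 1}, IsCompact K → ∀ C : Set ↥(unitaryGroupOfForm (starRingEnd ℂ) J), IsCompact C →
      ∃ 𝒦 : Set (↥(unitaryGroupOfForm (starRingEnd ℂ) J) ⧸ Subgroup.centralizer ({γ₁} : Set ↥(unitaryGroupOfForm (starRingEnd ℂ) J))), IsCompact 𝒦 ∧
        ∀ x ∈ K, ∀ y : ↥(unitaryGroupOfForm (starRingEnd ℂ) J), y * c x * y⁻¹ ∈ C →
          (QuotientGroup.mk y : ↥(unitaryGroupOfForm (starRingEnd ℂ) J) ⧸ Subgroup.centralizer ({γ₁} : Set ↥(unitaryGroupOfForm (starRingEnd ℂ) J))) ∈ 𝒦 :=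
  uniformlyProper_of_coe_eq_diagHyp₂ hJ hc a hca _ fun _ h01 h10 => mem_centralizer_of_apply_eq_zero₂ hγ₁ h01 h10

end Proper

/-! ## §4 Continuity on the regular set of the Weil-quotient orbital integral along the split chart -/

section Continuity

variable {J : Matrix (Fin 2) (Fin 2) ℂ} (hJ : J = Matrix.of fun i j : Fin 2 => if i.val + j.val + 1 = 2 then (1 : ℂ) else 0)
  {E : Type*} [NormedAddCommGroup E] [NormedSpace ℝ E]

/-- The regular set `{x ∣ |a(x)| ≠ 1}` of a continuous diagonal chart is open. [cite: Rogawski1990, §3.6 p. 31] -/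
theorem isOpen_setOf_norm_ne_one₂ {X : Type*} [TopologicalSpace X] {a : X → ℂ} (ha : Continuous a) : IsOpen {x | ‖a x‖ ≠ 1} :=
  isOpen_ne_fun ha.norm continuous_const

include hJ in
/-- **THE WEIL-QUOTIENT ORBITAL INTEGRAL IS CONTINUOUS ALONG THE REGULAR PART OF THE SPLIT CHART OF `U(Φ₂)(ℂ)`.**  Let `c : X → U(Φ₂)(ℂ)` be a continuous chart with diagonal
values `diag(a(x), ā(x)⁻¹)` (`X` locally compact; e.g. `(x, θ) ↦ diag(e^{x+iθ}, e^{−x+iθ})` = ★ `hypBlockGL`), `M` a subgroup containing the diagonal torus whose elements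
commute with every `c(x)` (e.g. the diagonal torus itself, or `Z(c(x₀))` at a regular `x₀`).  Then for `f ∈ C_c(U(Φ₂)(ℂ), E)` and ANY measure `μ` on `U(Φ₂)(ℂ) ⧸ M` finite on
compact sets (e.g. the Weil quotient `dν ∕ dt` of ★ `quotientMeasure`), `x ↦ ∫ f(y · c(x) · y⁻¹) dμ(ȳ)` (★ `descConj`) is continuous on `{x ∣ |a(x)| ≠ 1}`
(★ `continuousOn_integral_descConj_of_uniformlyProper` over §3).  The split-place input of «(W1-cont-H)» `continuousOn_chartOrbH_regS`.
[cite: Rogawski1990, §8.3 p. 122] [cite: Shelstad1979, §4 p. 22] [cite: DeitmarEchterhoff2014, Lemma 9.3.3] -/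
theorem continuousOn_integral_descConj_of_coe_eq_diagHyp₂ {X : Type*} [TopologicalSpace X] [LocallyCompactSpace X]
    {c : X → ↥(unitaryGroupOfForm (starRingEnd ℂ) J)} (hc : Continuous c) (a : X → ℂ)
    (hca : ∀ x, ((c x : GL (Fin 2) ℂ) : Matrix (Fin 2) (Fin 2) ℂ) = !![a x, 0; 0, (star (a x))⁻¹])
    (M : Subgroup ↥(unitaryGroupOfForm (starRingEnd ℂ) J))
    (hM : ∀ τ : ↥(unitaryGroupOfForm (starRingEnd ℂ) J),
      ((τ : GL (Fin 2) ℂ) : Matrix (Fin 2) (Fin 2) ℂ) 0 1 = 0 → ((τ : GL (Fin 2) ℂ) : Matrix (Fin 2) (Fin 2) ℂ) 1 0 = 0 → τ ∈ M)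
    (hcomm : ∀ x, ∀ m ∈ M, m * c x = c x * m)
    [MeasurableSpace (↥(unitaryGroupOfForm (starRingEnd ℂ) J) ⧸ M)] [OpensMeasurableSpace (↥(unitaryGroupOfForm (starRingEnd ℂ) J) ⧸ M)]
    (μ : Measure (↥(unitaryGroupOfForm (starRingEnd ℂ) J) ⧸ M)) [IsFiniteMeasureOnCompacts μ]
    {f : ↥(unitaryGroupOfForm (starRingEnd ℂ) J) → E} (hf : Continuous f) (hfc : HasCompactSupport f) :
    ContinuousOn (fun x => ∫ q, descConj (c x) M (hcomm x) f q ∂μ) {x | ‖a x‖ ≠ 1} := by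
  have hcoe : Continuous fun g : ↥(unitaryGroupOfForm (starRingEnd ℂ) J) => ((g : GL (Fin 2) ℂ) : Matrix (Fin 2) (Fin 2) ℂ) :=
    Units.continuous_val.comp continuous_subtype_val
  have ha : Continuous a := by
    have h : a = fun x => ((c x : GL (Fin 2) ℂ) : Matrix (Fin 2) (Fin 2) ℂ) 0 0 := by
      funext x; rw [hca x]; rfl
    rw [h]
    exact (hcoe.comp hc).matrix_elem 0 0
  exact continuousOn_integral_descConj_of_uniformlyProper M hc hcomm (isOpen_setOf_norm_ne_one₂ ha)
    (uniformlyProper_of_coe_eq_diagHyp₂ hJ hc a hca M hM) μ hf hfc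

end Continuity

end Literature.NumberTheory.Rogawski1990

end
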